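import Summits.AtomisticToContinuum.Crystallization.Theorems.NashClassCertificatesNashTwoShellGapVirial
import Summits.AtomisticToContinuum.Crystallization.Theorems.PhononSlackCertificatesAllBadGapFloor

/-!
# Crux `NashTwoShellGap` (stmt-AtomisticToContinuum-16826), line `birth`: the sharp global
# inverse-sixth-moment bound on the Nash class

From the virial identity (`NashTwoShellGapVirial.stub_nashVirial`, `stub_nashEnergyVirial`:
`∑_pairs r⁻⁶ = ∑_pairs r⁻¹²` and `𝓔_LJ(x) = −(1/12) ∑_pairs r⁻¹²` on the Nash class) and the
`g = 0` floor `N·e* ≤ 𝓔_LJ(x)` (`PhononSlackCertificatesAllBadGapFloor.allBadGap_zero`):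

  `S₆(x) := ∑_{i<j} |x_i − x_j|⁻⁶ = 12·|𝓔_LJ(x)| ≤ 12·N·|e*|`

for every `1/3`-separated Nash Lennard-Jones configuration — the GLOBAL use of the virial identity
recorded in `Cruxes/NashTwoShellGap/BarrierNotesIdeator2.md` (B2): the attractive moment of a Nash
cluster is bounded by the (unknown but fixed) periodic infimum, with constant `12`, no separation
constant entering.  No definitions; `[folklore]`.
-/

noncomputable section

namespace Summit.AtomisticToContinuum.Crystallization.Theorems.NashTwoShellGapInvSixMoment

open scoped BigOperators Classical
open Literature.MathematicalPhysics.StatisticalMechanics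

/-- **Registered sub-goal `stub_nashInvSixMoment`** (lead, line `birth`): on the Nash class
`∑_{i<j} r_ij⁻⁶ ≤ −12·N·e*` (`= 12 N |e*|`; virial + the `g = 0` floor). [folklore] -/
theorem stub_nashInvSixMoment : ∀ (N : ℕ) (x : Fin N → EuclideanSpace ℝ (Fin 3)), (∀ i j : Fin N, i ≠ j → 1 / 3 ≤ dist (x i) (x j)) → (∀ (i : Fin N) (y : EuclideanSpace ℝ (Fin 3)), (∀ j : Fin N, j ≠ i → y ≠ x j) → Literature.MathematicalPhysics.StatisticalMechanics.siteEnergy Literature.MathematicalPhysics.StatisticalMechanics.lennardJones x i ≤ ∑ j ∈ Finset.univ.erase i, Literature.MathematicalPhysics.StatisticalMechanics.lennardJones (dist y (x j))) → ∑ i : Fin N, ∑ j ∈ Finset.Ioi i, (dist (x i) (x j))⁻¹ ^ 6 ≤ -(12 * (N : ℝ) * (⨅ Q : Literature.MathematicalPhysics.StatisticalMechanics.PeriodicConfiguration 3, Q.energyPerParticle Literature.MathematicalPhysics.StatisticalMechanics.lennardJones)) := by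
  intro N x hsep hnash
  have hvir := NashTwoShellGapVirial.stub_nashVirial N x hsep hnash
  have hE := NashTwoShellGapVirial.stub_nashEnergyVirial N x hsep hnash
  have hfloor := PhononSlackCertificatesAllBadGapFloor.allBadGap_zero (by norm_num : (0 : ℝ) < 1 / 3) N x hsep
  have h6 : ∑ i : Fin N, ∑ j ∈ Finset.Ioi i, (dist (x i) (x j))⁻¹ ^ 6
      = ∑ i : Fin N, ∑ j ∈ Finset.Ioi i, (dist (x i) (x j))⁻¹ ^ 12 := by
    have : ∑ i : Fin N, ∑ j ∈ Finset.Ioi i, ((dist (x i) (x j))⁻¹ ^ 6 - (dist (x i) (x j))⁻¹ ^ 12)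
        = ∑ i : Fin N, ∑ j ∈ Finset.Ioi i, (dist (x i) (x j))⁻¹ ^ 6
          - ∑ i : Fin N, ∑ j ∈ Finset.Ioi i, (dist (x i) (x j))⁻¹ ^ 12 := by
      rw [← Finset.sum_sub_distrib]
      exact Finset.sum_congr rfl fun i _ => Finset.sum_sub_distrib _ _
    rw [this] at hvir
    linarith
  rw [h6]
  linarith

end Summit.AtomisticToContinuum.Crystallization.Theorems.NashTwoShellGapInvSixMoment

end
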